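import Summits.QuantumFields.YangMills.Theorems.BalabanUVNodesN15SiteCurvedOperatorEntries
import Summits.QuantumFields.YangMills.Theorems.BalabanUVNodesN15KingModelFullPropagatorByPartsNE2
import HarnessLib

/-!
# Route «BalabanUVNodes», cluster K4 «SpineRates» — node N15 = NE2: THE SITE LAYER WITH THE BACKGROUND LIVE IN THE TwoGrid ENTRY CURRENCY, XLI — THE RIGHT-ENTRY AND SHIFT
# LETTERS OF THE CURVED KING FAMILY: `A₀⁻¹N∇*_ν ⊗ 1` of King's full `A = 0` propagator on both grids — the dictionary with dag-n15-e's Σ-a object `kingSOp`, the coarse and fine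
# rows and the two-grid η-defect on the CLOSED mass range `0 ≤ m² ≤ m₀²`, and the unit-shift costs, read on part XXXIII's coloured carriers = the letters `hS`, `hS'`, `hDS`, `hSh`,
# `hSh'` of dag-n15-c's by-parts entry-2 theorem `hasMaj_entry2_byParts_matrix₂_of_letters` (FILE 23) AT THE CURVED KING FAMILY of parts XXXVI ∕ XL

Cell `pub-ymgap`, WIDTH SEAT `pub-ymgap-dag-n15-w1` (generation 5; director-ym №197 ∕ HUMAN RULING D-0149, №219 (1); chair R455 (A) ∕ R461; dag-lead KEY MAP v2 INBOX l.35754;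
the located sequel (o1) of dag-n15-e g15 INBOX l.39322 ∕ l.39620; dag-n15-d g18 l.40235 (door (2)); CLAIM-6).  `bears_on: R4∕N15 · K3⁸ SpineGivenEndpointR13SepCoPHV
(stmt-QuantumFields-27366; K3⁷ 20544 aside = lineage)`.  Filed `--kind proof --supports stmt-QuantumFields-27366 --as helper` — COUNT-NEUTRAL.  THEOREMS ONLY (0 `def`,
0 `sorry`).  Imports BY NAME part XXXVI `…N15SiteCurvedOperatorEntries` (p642830: `curvSrcF`, `curvSrcC`; through it part XXXIII `curvCube`, dag-n15-e Ω-b `kingGT`∕`kingGT₁`∕`kingGOp₁`,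
Ω-a `castT`∕`castT_sub_unitVec`∕`hasMaj_conjEquiv`∕`hasMaj_pullEquiv_comp`∕`idef_conj_eq`∕`blockOf_comp_blockOf_eq`, Σ-a `kingSOp`∕`kingFullProp_uniform_layer`, VII
`continuousAt_kingGOp_mass`∕`hasMaj_ofBlocks_of_massLimit`, dag-n15-c `tensorId`∕`hasMaj_tensorId`∕`idef_tensorId`, n15-c `fgradAdj`) and dag-n15-e Σ-d `…KingModelFullPropagatorByPartsNE2`
(p588500: `hasMaj_kingSOp_fine`; through it Σ-c `kingGOp_comp_fgradAdj`, `hasMaj_shiftT`); nothing in the tree is modified.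

WHY (ARCHITECTURE).  Entry 2 (`X∇*`) of (3.42) for the curved King family is DISPLAYED in parts XXXVI ∕ XL: the stacked knit would read the mixed rows `D_μG∇*_ν` (no `K`-uniform ℓ^∞
letter).  The door is dag-n15-c's BY-PARTS ENTRY-2 DEVICE, already generic in the tree (`…N15BackgroundEntry2ByParts` `e2ByParts` ∕ ★★ `hasMaj_idef_e2ByParts`; FILE 18
`…MatrixByPartsTwoSided` ★★ `e0_comp_fgradAdj_eq_e2ByParts_matrix₂` — `E₀∘∇_ν* = E₂∘ι_ν` for the two-sided MATRIX species `M_C + Σ_μ[M_{A_μ}∇_μ + M_{B_μ}∇⁻_μ]`, which IS n15-w3's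
`covSpeciesOpM … 1 C A` by `covSpeciesOpM_one`; FILE 23 ★★ `hasMaj_entry2_byParts_matrix₂_of_letters`; dag-n15-e Σ-c∕Σ-d = its scalar instantiation at King's model): NO mixed
kernel, every derivative on the right of the undressed propagator or on a coefficient.  FILE 23 reads four letter groups; THIS FILE types the first at the curved King family — the
`U ≡ 1` right entry `G ∘ fgradAdj N (liftEquiv τ_ν κ) = A₀⁻¹N∇*_ν ⊗ 1` (rows on both grids, two-grid η-defect) and the unit-shift costs — on the CLOSED mass range (the site
layer's `m² = 0` included, by part VII's continuity device, as part XXXVIII did for the Laplacian).  The other three groups (the curved coefficients' gradient ∕ translated-fit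
letters; Σ-c's shift-defect row letter `⊗` colour; the bridge `pr₀∘curvDressed … 1 S G = pr₀∘bgPairM₂ …`) are the located sequel.

CONTENTS.  §1 dictionary: `tensorId_comp_fgradAdj_liftEquiv`, `kingGT_comp_curvSrcC` (`= kingSOp ⊗ 1`), `kingGT₁_comp_curvSrcF` (`= (cast ∘ kingSOp′ ∘ cast⁻¹) ⊗ 1`),
`pull_liftEquiv_eq_tensorId`, `pull_torStep_nested_eq_conj`; §2 `continuousAt_kingSOp_mass`; §3 ★ `kingS_layer_massRange` (coarse rows = Σ-a conj. 3, fine rows = Σ-d, defect = Σ-a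
conj. 8, on `0 ≤ m² ≤ m₀²`); §4 ★★ `curvSrc_letters_massRange` (FILE 23's `hS`, `hS'`, `hDS` at the curved King family), ★ `curvShift_letters` (FILE 23's `hSh`, `hSh'`).

HONEST FRAMING ∕ LIMITS.  Count-neutral KNIT plumbing over landed theorems; no new estimate (inputs: Ψ-e ∕ Q4b via Σ-a, Σ-d, Σ-c §3, VII).  King's `A = 0` MODEL ([King1986] (2.13)
p. 653), `U ≡ 1` letters only; nothing of [B5]∕[B6]∕[B9] asserted ((3.42) p. 397 third entry = SHAPE).  It does NOT discharge entry 2 of part XXXVI by itself; NE2⁺ NOT PRINTED ∕ NOT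
proved for d = 4; **N15 is NOT discharged**; K3⁸ OPEN, not claimed, skeleton v6 untouched; counts of record UNMOVED (typed 28∕28 · discharged 5∕27, A 5∕28); one finite four-torus
programme at fixed `ε` — NOT ℝ⁴, NOT infinite volume, NOT OS, NOT a mass gap, NOT Clay; R4 closes the conditional finite-𝕋⁴ rung `BalabanLadder.UV` only.  HONEST SCOPE: odd
`L ≥ 3`, `a > 0`, cubes `2L^e`, `K ≥ 1`, one blocking step, `0 ≤ m² ≤ m₀²`, `0 ≤ γ < 1`, sharp block sup sizes.  Restate-immune (no Theses import).
-/

set_option autoImplicit false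

noncomputable section
open scoped BigOperators Matrix Topology

namespace Summit.QuantumFields.YangMills.BalabanUVNodes.N15.SiteLayerBg

open Real Finset Filter
open Literature.MathematicalPhysics.QuantumFieldTheory.Balaban1983to89
open Literature.MathematicalPhysics.QuantumFieldTheory.Balaban1983to89.B11SectG (BlockNorm HasMaj)
open Literature.MathematicalPhysics.QuantumFieldTheory.Balaban1983to89.T4EtaRateDefect (idef idef_apply)
open Literature.MathematicalPhysics.QuantumFieldTheory.Balaban1983to89.T4EtaRateCoeffDefect (pull pull_apply)
open Literature.MathematicalPhysics.QuantumFieldTheory.Balaban1983to89.B5Prop11Plancherel (Tor fine unitVec)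
open Literature.MathematicalPhysics.QuantumFieldTheory.King1986.Torus (blockOf tdistT tdistT_nonneg)
open Summit.QuantumFields.YangMills.BalabanUVNodes.N15.VectorPiece (unitTorusGeoS tensorId tensorId_apply hasMaj_tensorId idef_tensorId)
open Summit.QuantumFields.YangMills.BalabanUVNodes.N15.MatrixSpecies (liftMap liftBlk liftEquiv liftEquiv_apply liftEquiv_symm_apply)
open Summit.QuantumFields.YangMills.BalabanUVNodes.N15.BackgroundLayer (fgradAdj fgradAdj_apply)
open Summit.QuantumFields.YangMills.BalabanUVNodes.N15.CurvedSpecies (torStep torStep_symm_apply)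
open Summit.QuantumFields.YangMills.BalabanUVNodes.N15KingModelRung (KingVolIndex)
open Summit.QuantumFields.YangMills.BalabanUVNodes.N15KingModelRung.Curved

variable {d : ℕ} (L : ℕ) [NeZero L]
variable (κ : Type) [Fintype κ] [DecidableEq κ] (a : ℝ)

/-! ## §1 The dictionary: part XXXVI's sources after King's propagator `⊗ 1` are dag-n15-e's `kingSOp ⊗ 1`; lifted shifts are `⊗ 1` of shifts -/

section Dictionary

omit [NeZero L] [Fintype κ] [DecidableEq κ] in
/-- `(T ⊗ 1) ∘ (∇*_s ⊗ 1) = (T ∘ ∇*_s) ⊗ 1` for the colour-lifted step `liftEquiv s κ`. [folklore] -/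
theorem tensorId_comp_fgradAdj_liftEquiv {Y : Type} (T : (Y → ℝ) →ₗ[ℝ] (Y → ℝ)) (n : ℝ) (s : Y ≃ Y) :
    tensorId κ T ∘ₗ fgradAdj n (liftEquiv s κ) = tensorId κ (T ∘ₗ fgradAdj n s) := by
  refine LinearMap.ext fun f => funext fun p => ?_
  simp only [LinearMap.comp_apply, tensorId_apply, fgradAdj_apply, liftEquiv_symm_apply]
  exact congrArg (fun g => T g p.1) (funext fun x => by simp only [fgradAdj_apply])

omit [NeZero L] [Fintype κ] [DecidableEq κ] in
/-- The colour-lifted pull-back IS `⊗ 1` of the pull-back: `pull (liftEquiv s κ) = (pull s) ⊗ 1`. [folklore] -/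
theorem pull_liftEquiv_eq_tensorId {Y : Type} (s : Y ≃ Y) : pull ⇑(liftEquiv s κ) = tensorId κ (pull (⇑s : Y → Y)) := by
  refine LinearMap.ext fun f => funext fun p => ?_
  simp only [pull_apply, tensorId_apply, liftEquiv_apply]

omit [Fintype κ] [DecidableEq κ] in
/-- COARSE: `(A₀⁻¹ ⊗ 1) ∘ (N∇*_ν ⊗ 1) = (A₀⁻¹N∇*_ν) ⊗ 1 = kingSOp_ν ⊗ 1` (`N = L^K`; Σ-c `kingGOp_comp_fgradAdj`). [cite: King1986, (4.1)–(4.5) p.670; Balaban1985BackgroundPropagators, (3.42) p.397 (third entry, shape)] -/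
theorem kingGT_comp_curvSrcC (i : KingVolIndex d) (msq : ℝ) (ν : Fin (d + 1)) :
    kingGT L a msq i.K (curvCube L i) κ ∘ₗ curvSrcC L κ i ν = tensorId κ (kingSOp L a msq i.K (L ^ i.K) (curvCube L i) ν) := by
  rw [curvSrcC, kingGT, tensorId_comp_fgradAdj_liftEquiv, ← kingGOp_comp_fgradAdj, Nat.cast_pow]
  rfl

omit [Fintype κ] [DecidableEq κ] in
/-- FINE, THROUGH THE CAST: `(G′₁ ⊗ 1) ∘ (N′∇′*_ν ⊗ 1) = (cast ∘ kingSOp′_ν ∘ cast⁻¹) ⊗ 1` (`N′ = L·L^K`; the cast is a translation homomorphism). [cite: King1986, (2.20) p.654, (4.1)–(4.5) p.670] -/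
theorem kingGT₁_comp_curvSrcF (i : KingVolIndex d) (msq : ℝ) (ν : Fin (d + 1)) :
    kingGT₁ L a msq i.K (curvCube L i) κ ∘ₗ curvSrcF L κ i ν =
      tensorId κ (pull ⇑(castT L i.K (curvCube L i)) ∘ₗ kingSOp L a msq (i.K + 1) (L ^ 1 * L ^ i.K) (curvCube L i) ν ∘ₗ pull ⇑(castT L i.K (curvCube L i)).symm) := by
  rw [curvSrcF, kingGT₁, tensorId_comp_fgradAdj_liftEquiv, ← kingGOp_comp_fgradAdj]
  congr 1
  refine LinearMap.ext fun f => funext fun y' => ?_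
  have hn : ((L ^ 1 * L ^ i.K : ℕ) : ℝ) = (L : ℝ) ^ (i.K + 1) := by push_cast; ring
  have hz : ∀ z : Tor (fine (L ^ 1 * L ^ i.K) (curvCube L i)),
      (castT L i.K (curvCube L i)).symm (z - unitVec (fine (L ^ 1 * L ^ i.K) (curvCube L i)) ν) = (castT L i.K (curvCube L i)).symm z - unitVec (fine L (fine (L ^ i.K) (curvCube L i))) ν :=
    fun z => by rw [Equiv.symm_apply_eq, castT_sub_unitVec, Equiv.apply_symm_apply]
  simp only [kingGOp₁, LinearMap.comp_apply, pull_apply]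
  refine congrArg (fun g => kingGOp L a msq (i.K + 1) (L ^ 1 * L ^ i.K) (curvCube L i) g (castT L i.K (curvCube L i) y')) (funext fun z => ?_)
  simp only [pull_apply, fgradAdj_apply, torStep_symm_apply, kingTorusLine_unitVec_eq, Equiv.addRight_symm, Equiv.coe_addRight, ← sub_eq_add_neg, hz, hn]

omit [NeZero L] [Fintype κ] [DecidableEq κ] in
/-- The nested fine unit shift is the cast-conjugate of the fine unit shift: `pull τ′_μ = pull cast ∘ pull (· + e_μ) ∘ pull cast⁻¹`. [cite: King1986, (2.20) p.654] -/
theorem pull_torStep_nested_eq_conj (i : KingVolIndex d) (μ : Fin (d + 1)) :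
    pull ⇑(torStep (fine L (fine (L ^ i.K) (curvCube L i))) μ) =
      pull ⇑(castT L i.K (curvCube L i)) ∘ₗ pull ⇑(Equiv.addRight (unitVec (fine (L ^ 1 * L ^ i.K) (curvCube L i)) μ)) ∘ₗ pull ⇑(castT L i.K (curvCube L i)).symm := by
  refine LinearMap.ext fun f => funext fun y' => ?_
  simp only [LinearMap.comp_apply, pull_apply, torStep, Equiv.coe_addRight, kingTorusLine_unitVec_eq, ← castT_add_unitVec, Equiv.symm_apply_apply]

end Dictionary

/-! ## §2 Continuity of the right entry in the mass at `m² = 0` -/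

section Continuity

variable (M : Fin (d + 1) → ℕ) [∀ μ, NeZero (M μ)] (N : ℕ) [NeZero N]

omit [NeZero L] in
/-- `m² ↦ (A₀(a_K, N², m²)⁻¹N∇*_νλ)(x)` is continuous at `m² = 0` (it is `A₀⁻¹` applied to the fixed function `N∇*_νλ`; part VII). [cite: King1986, (4.1)–(4.5) p.670; Balaban1984PropagatorsI, p.25] -/
theorem continuousAt_kingSOp_mass (hL : 1 < L) (ha : 0 < a) {K : ℕ} (hK : 1 ≤ K) (ν : Fin (d + 1)) (lam : Tor (fine N M) → ℝ) (x : Tor (fine N M)) :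
    ContinuousAt (fun m2 : ℝ => kingSOp L a m2 K N M ν lam x) 0 := by
  have h : ∀ m2 : ℝ, kingSOp L a m2 K N M ν lam x = kingGOp L a m2 K N M (fgradAdj (N : ℝ) (Equiv.addRight (unitVec (fine N M) ν)) lam) x := fun m2 => by
    rw [← kingGOp_comp_fgradAdj, LinearMap.comp_apply]
  simp only [h]
  exact continuousAt_kingGOp_mass M N L hL ha hK _ x

end Continuity

/-! ## §3 ★ dag-n15-e's right-entry letters at `n = 1` on the closed mass range -/

section Scalar

/-- ★ **THE RIGHT-ENTRY ROWS (COARSE AND FINE) AND THE RIGHT-ENTRY DEFECT ON `0 ≤ m² ≤ m₀²`** (Σ-a `kingFullProp_uniform_layer`, conjuncts 3 and 8, and Σ-d `hasMaj_kingSOp_fine`, at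
`n = 1` on `(0, m₀² + 1]`; at `m² = 0` their limit by part VII `hasMaj_ofBlocks_of_massLimit` + §2): for odd `L ≥ 3`, `a > 0`, `m₀² ≥ 0`, `0 ≤ γ < 1` there are `β, δ, m₀ > 0` with, for
every `K ≥ 1`, cube `2L^e`, mass `0 ≤ m² ≤ m₀²`, `Msz`, direction `ν`: `A₀⁻¹N∇*_ν ≤ βe^{−δ|y−y′|_T}` (coarse), `A₀′⁻¹N′∇′*_ν ≤ βe^{−δ|y−y′|_T}` (fine blocks → fine blocks) and
`𝔇(A₀′⁻¹N′∇′*_ν, A₀⁻¹N∇*_ν) ≤ m₀(L^K)^{−γ∕2}e^{−δ|y−y′|_T}` through King's pairing.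
[cite: King1986, (2.17) p.653, Prop. 3.9 (3.73) p.665, (4.1)–(4.5) p.670; Balaban1985BackgroundPropagators, Thm 3.1 (3.42)–(3.43) pp.397–398 (third entry, shape); Balaban1984PropagatorsI, p.25 (massless `G′`)] -/
theorem kingS_layer_massRange (hLodd : Odd L) (hL : 2 ≤ L) (ha : 0 < a) {m0sq : ℝ} (hm0 : 0 ≤ m0sq) {γ : ℝ} (hγ0 : 0 ≤ γ) (hγ1 : γ < 1) :
    ∃ β δ m₀ : ℝ, 0 < β ∧ 0 < δ ∧ 0 < m₀ ∧ ∀ (K : ℕ), 1 ≤ K → ∀ (e : ℕ) (M : Fin (d + 1) → ℕ) [∀ μ, NeZero (M μ)], (∀ μ, M μ = 2 * L ^ e) →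
      ∀ (msq : ℝ), 0 ≤ msq → msq ≤ m0sq → ∀ (Msz : ℝ) (ν : Fin (d + 1)),
      HasMaj (BlockNorm.ofBlocks (unitTorusGeoS L K M Msz) (blockOf (L ^ K) M)) (BlockNorm.ofBlocks (unitTorusGeoS L K M Msz) (blockOf (L ^ K) M))
          (kingSOp L a msq K (L ^ K) M ν) (fun y y' => β * Real.exp (-(δ * tdistT M y y')))
      ∧ HasMaj (BlockNorm.ofBlocks (unitTorusGeoS L K M Msz) (blockOf (L ^ K) M ∘ underPtN L K 1 M))
          (BlockNorm.ofBlocks (unitTorusGeoS L K M Msz) (blockOf (L ^ K) M ∘ underPtN L K 1 M))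
          (kingSOp L a msq (K + 1) (L ^ 1 * L ^ K) M ν) (fun y y' => β * Real.exp (-(δ * tdistT M y y')))
      ∧ HasMaj (BlockNorm.ofBlocks (unitTorusGeoS L K M Msz) (blockOf (L ^ K) M))
          (BlockNorm.ofBlocks (unitTorusGeoS L K M Msz) (blockOf (L ^ K) M ∘ underPtN L K 1 M))
          (idef (pull (underPtN L K 1 M)) (pull (underPtN L K 1 M)) (kingSOp L a msq (K + 1) (L ^ 1 * L ^ K) M ν) (kingSOp L a msq K (L ^ K) M ν))
          (fun y y' => m₀ * ((L : ℝ) ^ K) ^ (-(γ / 2)) * Real.exp (-(δ * tdistT M y y'))) := by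
  obtain ⟨β₁, δ₁, m₀, hβ₁, hδ₁, hm₀, H⟩ := kingFullProp_uniform_layer (d := d) L hLodd hL ha (show (0 : ℝ) ≤ m0sq + 1 by linarith) hγ0 hγ1
  obtain ⟨β₂, δ₂, hβ₂, hδ₂, HS⟩ := hasMaj_kingSOp_fine (d := d) L hLodd hL ha (show (0 : ℝ) ≤ m0sq + 1 by linarith)
  have hLr : (0 : ℝ) ≤ (L : ℝ) := Nat.cast_nonneg _
  -- one `(β, δ)` for the three letters
  refine ⟨max β₁ β₂, min δ₁ δ₂, m₀, lt_max_of_lt_left hβ₁, lt_min hδ₁ hδ₂, hm₀, fun K hK e M _ hM msq hmsq hcap Msz ν => ?_⟩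
  have wk : ∀ {β δ : ℝ} (_ : 0 ≤ β) (_ : β ≤ max β₁ β₂) (_ : min δ₁ δ₂ ≤ δ) (y y' : Tor M),
      β * Real.exp (-(δ * tdistT M y y')) ≤ max β₁ β₂ * Real.exp (-(min δ₁ δ₂ * tdistT M y y')) := fun hb hbm hdm y y' =>
    mul_le_mul hbm (Real.exp_le_exp.mpr (by nlinarith [tdistT_nonneg M y y'])) (Real.exp_nonneg _) (hb.trans hbm)
  have wkm : ∀ y y' : Tor M, m₀ * ((L : ℝ) ^ K) ^ (-(γ / 2)) * Real.exp (-(δ₁ * tdistT M y y')) ≤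
      m₀ * ((L : ℝ) ^ K) ^ (-(γ / 2)) * Real.exp (-(min δ₁ δ₂ * tdistT M y y')) := fun y y' =>
    mul_le_mul_of_nonneg_left (Real.exp_le_exp.mpr (by nlinarith [tdistT_nonneg M y y', min_le_left δ₁ δ₂]))
      (mul_nonneg hm₀.le (Real.rpow_nonneg (pow_nonneg hLr _) _))
  have hL1 : 1 < L := by omega
  have hm1 : (0 : ℝ) < m0sq + 1 := by linarith
  have hK1 : 1 ≤ K + 1 := Nat.le_add_left 1 K
  -- the three letters on `(0, m₀² + 1]`
  have HK := fun (m2 : ℝ) (hm2 : 0 < m2) (hcap2 : m2 ≤ m0sq + 1) => H K hK 1 le_rfl e M hM m2 hm2 hcap2 Msz ν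
  have HSK := fun (m2 : ℝ) (hm2 : 0 < m2) (hcap2 : m2 ≤ m0sq + 1) => HS K hK 1 e M hM m2 hm2 hcap2 Msz ν
  -- at every `0 ≤ m² ≤ m₀²`: positive masses directly, `m² = 0` by the limit device
  have three : HasMaj (BlockNorm.ofBlocks (unitTorusGeoS L K M Msz) (blockOf (L ^ K) M)) (BlockNorm.ofBlocks (unitTorusGeoS L K M Msz) (blockOf (L ^ K) M))
        (kingSOp L a msq K (L ^ K) M ν) (fun y y' => β₁ * Real.exp (-(δ₁ * tdistT M y y')))
      ∧ HasMaj (BlockNorm.ofBlocks (unitTorusGeoS L K M Msz) (blockOf (L ^ K) M ∘ underPtN L K 1 M))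
        (BlockNorm.ofBlocks (unitTorusGeoS L K M Msz) (blockOf (L ^ K) M ∘ underPtN L K 1 M))
        (kingSOp L a msq (K + 1) (L ^ 1 * L ^ K) M ν) (fun y y' => β₂ * Real.exp (-(δ₂ * tdistT M y y')))
      ∧ HasMaj (BlockNorm.ofBlocks (unitTorusGeoS L K M Msz) (blockOf (L ^ K) M))
        (BlockNorm.ofBlocks (unitTorusGeoS L K M Msz) (blockOf (L ^ K) M ∘ underPtN L K 1 M))
        (idef (pull (underPtN L K 1 M)) (pull (underPtN L K 1 M)) (kingSOp L a msq (K + 1) (L ^ 1 * L ^ K) M ν) (kingSOp L a msq K (L ^ K) M ν))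
        (fun y y' => m₀ * ((L : ℝ) ^ K) ^ (-(γ / 2)) * Real.exp (-(δ₁ * tdistT M y y'))) := by
    rcases hmsq.lt_or_eq with hpos | h0
    · exact ⟨(HK msq hpos (by linarith)).2.2.1, HSK msq hpos (by linarith), (HK msq hpos (by linarith)).2.2.2.2.2.2.2.1⟩
    subst h0
    refine ⟨?_, ?_, ?_⟩
    · exact hasMaj_ofBlocks_of_massLimit (g := unitTorusGeoS L K M Msz) (blockOf (L ^ K) M) (blockOf (L ^ K) M) (fun m2 => kingSOp L a m2 K (L ^ K) M ν) _ hm1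
        (fun lam x => continuousAt_kingSOp_mass L a M (L ^ K) hL1 ha hK ν lam x) (fun m2 hm2 hcap2 => (HK m2 hm2 hcap2).2.2.1)
    · exact hasMaj_ofBlocks_of_massLimit (g := unitTorusGeoS L K M Msz) (blockOf (L ^ K) M ∘ underPtN L K 1 M) (blockOf (L ^ K) M ∘ underPtN L K 1 M)
        (fun m2 => kingSOp L a m2 (K + 1) (L ^ 1 * L ^ K) M ν) _ hm1
        (fun lam x => continuousAt_kingSOp_mass L a M (L ^ 1 * L ^ K) hL1 ha hK1 ν lam x) (fun m2 hm2 hcap2 => HSK m2 hm2 hcap2)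
    · refine hasMaj_ofBlocks_of_massLimit (g := unitTorusGeoS L K M Msz) (blockOf (L ^ K) M) (blockOf (L ^ K) M ∘ underPtN L K 1 M)
        (fun m2 => idef (pull (underPtN L K 1 M)) (pull (underPtN L K 1 M)) (kingSOp L a m2 (K + 1) (L ^ 1 * L ^ K) M ν) (kingSOp L a m2 K (L ^ K) M ν)) _ hm1
        (fun lam x' => ?_) (fun m2 hm2 hcap2 => (HK m2 hm2 hcap2).2.2.2.2.2.2.2.1)
      simp only [idef_apply, Pi.sub_apply, pull_apply]
      exact (continuousAt_kingSOp_mass L a M (L ^ 1 * L ^ K) hL1 ha hK1 ν _ x').sub (continuousAt_kingSOp_mass L a M (L ^ K) hL1 ha hK ν lam _)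
  obtain ⟨h3, hf, h8⟩ := three
  exact ⟨h3.mono fun y y' => wk hβ₁.le (le_max_left _ _) (min_le_left _ _) y y', hf.mono fun y y' => wk hβ₂.le (le_max_right _ _) (min_le_right _ _) y y',
    h8.mono fun y y' => wkm y y'⟩

end Scalar

/-! ## §4 ★★ The right-entry letters and the shift costs on part XXXIII's coloured carriers (FILE 23's `hS`, `hS'`, `hDS`, `hSh`, `hSh'` at the curved King family) -/

section Coloured

omit [DecidableEq κ] in
/-- ★★ **THE RIGHT-ENTRY LETTERS OF THE CURVED KING FAMILY** (the `U ≡ 1` right entry `G ∘ ∇*_ν` of dag-n15-c's FILE 23 at parts XXXVI ∕ XL's family): for odd `L ≥ 3`, `a > 0`, `m₀² ≥ 0`,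
`0 ≤ γ < 1` there are `β_S, δ_S, m_S > 0` such that for every index `i`, every mass `0 ≤ m² ≤ m₀²` (the site layer's `m² = 0` included) and every direction `ν`: the coarse right entry
`(G ⊗ 1) ∘ curvSrcC ν = A₀⁻¹N∇*_ν ⊗ 1` has rows `β_Se^{−δ_S|y−y′|_T}` on the coloured coarse cubes, the fine one `(G′₁ ⊗ 1) ∘ curvSrcF ν` has the same rows on the coloured nested fine
cubes, and their two-grid defect through the colour-lifted one-step block map is `≤ m_S(L^K)^{−γ∕2}e^{−δ_S|y−y′|_T}` — §3 through §1's dictionary, dag-n15-c's lift (`hasMaj_tensorId`,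
`idef_tensorId`) and dag-n15-e's cast (`hasMaj_conjEquiv`, `idef_conj_eq`, `hasMaj_pullEquiv_comp`).
[cite: King1986, (2.17) p.653, (2.20) p.654, Prop. 3.9 (3.73) p.665, p.664 (pairing); Balaban1985BackgroundPropagators, Thm 3.1 (3.42)–(3.43) pp.397–398 (third entry, shape)] -/
theorem curvSrc_letters_massRange (hLodd : Odd L) (hL : 2 ≤ L) (ha : 0 < a) {m0sq : ℝ} (hm0 : 0 ≤ m0sq) {γ : ℝ} (hγ0 : 0 ≤ γ) (hγ1 : γ < 1) :
    ∃ β δ m₀ : ℝ, 0 < β ∧ 0 < δ ∧ 0 < m₀ ∧ ∀ (i : KingVolIndex d) (msq : ℝ), 0 ≤ msq → msq ≤ m0sq → ∀ ν : Fin (d + 1),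
      HasMaj (BlockNorm.ofBlocks (unitTorusGeoS L i.K (curvCube L i) i.Msz) (liftBlk (blockOf (L ^ i.K) (curvCube L i)) κ))
          (BlockNorm.ofBlocks (unitTorusGeoS L i.K (curvCube L i) i.Msz) (liftBlk (blockOf (L ^ i.K) (curvCube L i)) κ))
          (kingGT L a msq i.K (curvCube L i) κ ∘ₗ curvSrcC L κ i ν) (fun y y' => β * Real.exp (-(δ * tdistT (curvCube L i) y y')))
      ∧ HasMaj (BlockNorm.ofBlocks (unitTorusGeoS L i.K (curvCube L i) i.Msz) (liftBlk (blockOf (L ^ i.K) (curvCube L i) ∘ blockOf L (fine (L ^ i.K) (curvCube L i))) κ))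
          (BlockNorm.ofBlocks (unitTorusGeoS L i.K (curvCube L i) i.Msz) (liftBlk (blockOf (L ^ i.K) (curvCube L i) ∘ blockOf L (fine (L ^ i.K) (curvCube L i))) κ))
          (kingGT₁ L a msq i.K (curvCube L i) κ ∘ₗ curvSrcF L κ i ν) (fun y y' => β * Real.exp (-(δ * tdistT (curvCube L i) y y')))
      ∧ HasMaj (BlockNorm.ofBlocks (unitTorusGeoS L i.K (curvCube L i) i.Msz) (liftBlk (blockOf (L ^ i.K) (curvCube L i)) κ))
          (BlockNorm.ofBlocks (unitTorusGeoS L i.K (curvCube L i) i.Msz) (liftBlk (blockOf (L ^ i.K) (curvCube L i) ∘ blockOf L (fine (L ^ i.K) (curvCube L i))) κ))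
          (idef (pull (liftMap (blockOf L (fine (L ^ i.K) (curvCube L i))) κ)) (pull (liftMap (blockOf L (fine (L ^ i.K) (curvCube L i))) κ))
            (kingGT₁ L a msq i.K (curvCube L i) κ ∘ₗ curvSrcF L κ i ν) (kingGT L a msq i.K (curvCube L i) κ ∘ₗ curvSrcC L κ i ν))
          (fun y y' => m₀ * ((L : ℝ) ^ i.K) ^ (-(γ / 2)) * Real.exp (-(δ * tdistT (curvCube L i) y y'))) := by
  obtain ⟨β, δ, m₀, hβ, hδ, hm₀, H⟩ := kingS_layer_massRange (d := d) L a hLodd hL ha hm0 hγ0 hγ1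
  refine ⟨β, δ, m₀, hβ, hδ, hm₀, fun i msq hmsq hcap ν => ?_⟩
  have hLr : (0 : ℝ) ≤ (L : ℝ) := Nat.cast_nonneg _
  obtain ⟨h3, hf, h8⟩ := H i.K i.one_le_K i.m (curvCube L i) (fun _ => rfl) msq hmsq hcap i.Msz ν
  have maj0 : ∀ y y' : Tor (curvCube L i), 0 ≤ β * Real.exp (-(δ * tdistT (curvCube L i) y y')) := fun _ _ => by positivity
  have majm : ∀ y y' : Tor (curvCube L i), 0 ≤ m₀ * ((L : ℝ) ^ i.K) ^ (-(γ / 2)) * Real.exp (-(δ * tdistT (curvCube L i) y y')) :=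
    fun _ _ => mul_nonneg (mul_nonneg hm₀.le (Real.rpow_nonneg (pow_nonneg hLr _) _)) (Real.exp_nonneg _)
  refine ⟨?_, ?_, ?_⟩
  · rw [kingGT_comp_curvSrcC]
    exact hasMaj_tensorId κ maj0 h3
  · rw [kingGT₁_comp_curvSrcF, blockOf_comp_blockOf_eq]
    exact hasMaj_tensorId κ maj0 (hasMaj_conjEquiv _ _ (castT L i.K (curvCube L i)) maj0 hf)
  · rw [kingGT₁_comp_curvSrcF, kingGT_comp_curvSrcC, idef_tensorId]
    refine hasMaj_tensorId κ majm ?_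
    rw [idef_conj_eq, blockOf_comp_blockOf_eq]
    exact hasMaj_pullEquiv_comp _ (castT L i.K (curvCube L i)) majm h8

omit [DecidableEq κ] in
/-- ★ **THE UNIT-SHIFT COSTS ON THE COLOURED CARRIERS** (FILE 23's `hSh`, `hSh'` at the curved King family): for every `ρ ≥ 0`, index `i`, direction `μ`, the colour-lifted coarse unit
shift `pull (liftEquiv τ_μ κ)` and the colour-lifted nested fine unit shift `pull (liftEquiv τ′_μ κ)` are `≤ e^{ρ}·e^{−ρ|y−y′|_T}` between the sharp coloured block sizes (Σ-c
`hasMaj_shiftT` `⊗ 1`, the fine one through the cast). [cite: King1986, p.664 (unit blocks), (2.20) p.654; Balaban1985BackgroundPropagators, (3.64)–(3.65) p.402 (mechanism: one-site shifts)] -/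
theorem curvShift_letters {ρ : ℝ} (hρ : 0 ≤ ρ) (i : KingVolIndex d) (μ : Fin (d + 1)) :
    HasMaj (BlockNorm.ofBlocks (unitTorusGeoS L i.K (curvCube L i) i.Msz) (liftBlk (blockOf (L ^ i.K) (curvCube L i)) κ))
        (BlockNorm.ofBlocks (unitTorusGeoS L i.K (curvCube L i) i.Msz) (liftBlk (blockOf (L ^ i.K) (curvCube L i)) κ))
        (pull ⇑(liftEquiv (torStep (fine (L ^ i.K) (curvCube L i)) μ) κ)) (fun y y' => Real.exp ρ * Real.exp (-(ρ * tdistT (curvCube L i) y y')))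
    ∧ HasMaj (BlockNorm.ofBlocks (unitTorusGeoS L i.K (curvCube L i) i.Msz) (liftBlk (blockOf (L ^ i.K) (curvCube L i) ∘ blockOf L (fine (L ^ i.K) (curvCube L i))) κ))
        (BlockNorm.ofBlocks (unitTorusGeoS L i.K (curvCube L i) i.Msz) (liftBlk (blockOf (L ^ i.K) (curvCube L i) ∘ blockOf L (fine (L ^ i.K) (curvCube L i))) κ))
        (pull ⇑(liftEquiv (torStep (fine L (fine (L ^ i.K) (curvCube L i))) μ) κ)) (fun y y' => Real.exp ρ * Real.exp (-(ρ * tdistT (curvCube L i) y y'))) := by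
  have maj0 : ∀ y y' : Tor (curvCube L i), 0 ≤ Real.exp ρ * Real.exp (-(ρ * tdistT (curvCube L i) y y')) := fun _ _ => by positivity
  refine ⟨?_, ?_⟩
  · rw [pull_liftEquiv_eq_tensorId]
    exact hasMaj_tensorId κ maj0 (hasMaj_shiftT L i.K (L ^ i.K) (curvCube L i) i.Msz hρ μ)
  · rw [pull_liftEquiv_eq_tensorId, pull_torStep_nested_eq_conj, blockOf_comp_blockOf_eq, blockOf_comp_underPtN]
    exact hasMaj_tensorId κ maj0 (hasMaj_conjEquiv _ _ (castT L i.K (curvCube L i)) maj0 (hasMaj_shiftT L i.K (L ^ 1 * L ^ i.K) (curvCube L i) i.Msz hρ μ))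

end Coloured

end Summit.QuantumFields.YangMills.BalabanUVNodes.N15.SiteLayerBg

end
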